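import Mathlib
import HarnessLib
import Literature.MathematicalPhysics.QuantumLattice.HubbardMatsubaraCutoffEffAction
import Literature.MathematicalPhysics.QuantumLattice.HubbardMatsubaraShellRowSum
import Literature.MathematicalPhysics.QuantumLattice.HubbardMatsubaraShellGram
import Summits.HubbardSuperconductivity.HubbardSuperconductivity.Theorems.KLProgrammeKLRegimeVolumeLimitDefs

/-!
# Route `KLProgramme` — crux K3, child 4 VL (stmt-HubbardSuperconductivity-20440), located risk #8 «(VL)-DEAD-LEG»: the SCALAR of the dressed
# read-out — the last-scale dressing factor `C(ω_i, k⃗) = uvSymbolCT V M β μ K Λ_{n⋆} ((i,k⃗),σ)` is the FULL propagator symbol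
# `βV²·(iω + e_K)/(ω² + e_K²)`, with TWO-SIDED bounds uniform in the volume and in the Matsubara cutoff (one `w₀` per Matsubara integer)

Cell gate-hubbard-kl, seat hubbard-kl-k3c4-p2 g10.  Pen (R59an): the covariance data of the UV-dressed propagator are read ONCE, by the dressed read-out —
k3c5-p3's END door `TwoPointAssembly.framedNestedFlowTextV17F2_of_commonFrameWeightedDualRows` (p563659) takes a weight `w k` with `w₀ ≤ ‖w k‖` at
every lattice momentum of a fixed Matsubara integer `n`, `w` = the dressing `C(ω_n, p_k)²` of the source legs (VL-INDUCTION-BLUEPRINT-g9 §B: «`|C|⁻¹ ≤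
π(2|n|+1)/β + 4 + |μ| + ‖K‖`, a constant per Matsubara integer»).  This file supplies that scalar, normalisation-free (both `‖C‖` and `‖C‖/(βV²)`):

* `uvSymbolCT_eq_full_of_scale_le_abs_freq` — above the scale (`0 < Λ ≤ |ω_i|`) the weight is `1`: `C = βV²·(iω_i + e_K(k⃗))/(ω_i² + e_K(k⃗)²)`;
* `norm_uvSymbolCT_eq_of_scale_le_abs_freq` — `‖C‖ = βV²/√(ω_i² + e_K²)`;
* **`norm_uvSymbolCT_ge_of_scale_le_abs_freq`** — `βV²/(|ω_i| + 4 + |μ| + ‖K‖₀) ≤ ‖C‖` (`‖K‖₀ = K.coeffNorm 0`, `abs_nambuXiCT_le`);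
* **`norm_uvSymbolCT_lastScale_ge`** / **`…_le`** — at `Λ⋆ = klScale klE0 (nScales β + 1)` (`Λ⋆ < π/β ≤ |ω_i|`, `klScale_nScales_succ_lt`), for EVERY `i`, `k⃗`, `σ`,
  `V`, `M`: `βV²/(|ω_i| + 4 + |μ| + ‖K‖₀) ≤ ‖C‖ ≤ βV²·β/π`; **`norm_uvSymbolCT_lastScale_ge_of_matsubaraInt`** — at the labels of the integer `n`:
  `βV²/(π(2|n|+1)/β + 4 + |μ| + ‖K‖₀) ≤ ‖C‖` — the `w₀` of the door up to the consumer's normalisation (squares / `(βV²)⁻¹` by `norm_pow`, `norm_div`).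

Everything is proved; no definitions, no named facts.
-/

noncomputable section

namespace Summit.HubbardSuperconductivity.HubbardSuperconductivity.Theorems.UVCovarianceAt

set_option linter.dupNamespace false -- summit = problem name (single-conjunct summit), D-0017

open Real Complex Literature.MathematicalPhysics.QuantumLattice Literature.Probability.LatticeModels
open Summit.HubbardSuperconductivity.HubbardSuperconductivity.Theorems.KLRegimeSplit
open Summit.HubbardSuperconductivity.HubbardSuperconductivity.Theorems.KLProgrammeLegKernels

variable {L M : ℕ} [NeZero L] {β μ Λ : ℝ} {K : TrigPolyC4v}

/-! ## §1 Above the scale the UV symbol is the full propagator symbol -/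

/-- **Weight `1` above the scale**: for `0 < Λ ≤ |ω_i|`, `uvSymbolCT V M β μ K Λ ((i,k⃗),σ) = βV²·(iω_i + e_K(k⃗))/(ω_i² + e_K(k⃗)²)`. -/
theorem uvSymbolCT_eq_full_of_scale_le_abs_freq (hΛ : 0 < Λ) (i : MatsubaraIdx M) (hi : Λ ≤ |matsubaraFreq β M i|) (k : TorusSite 2 L) (σ : Fin 2) :
    uvSymbolCT L M β μ K Λ ((i, k), σ) =
      ((β * (L : ℝ) ^ 2 : ℝ) : ℂ) * ((I * (matsubaraFreq β M i : ℂ) + (nambuXiCT L μ K k : ℂ)) /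
        (((matsubaraFreq β M i ^ 2 + nambuXiCT L μ K k ^ 2 : ℝ)) : ℂ)) := by
  unfold uvSymbolCT
  rw [hubbardCutoffWeightCT_eq_one_of_le (L := L) (β := β) (μ := μ) (K := K) hΛ (k := (i, k)) hi, nambuDenCT_zero_seed]
  push_cast
  ring

/-- `‖(iω + e)/(ω² + e²)‖ = 1/√(ω² + e²)`. -/
theorem norm_I_mul_add_div_sq (ω ξ : ℝ) :
    ‖(I * (ω : ℂ) + (ξ : ℂ)) / (((ω ^ 2 + ξ ^ 2 : ℝ)) : ℂ)‖ = 1 / Real.sqrt (ω ^ 2 + ξ ^ 2) := by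
  have hnum : ‖I * (ω : ℂ) + (ξ : ℂ)‖ = Real.sqrt (ω ^ 2 + ξ ^ 2) := by
    rw [Complex.norm_eq_sqrt_sq_add_sq]
    congr 1
    simp [Complex.add_re, Complex.add_im, Complex.mul_re, Complex.mul_im]
    ring
  rw [norm_div, hnum, Complex.norm_real, Real.norm_eq_abs, abs_of_nonneg (by positivity)]
  by_cases h0 : ω ^ 2 + ξ ^ 2 = 0
  · rw [h0, Real.sqrt_zero]; simp
  · have hpos : 0 < ω ^ 2 + ξ ^ 2 := lt_of_le_of_ne (by positivity) (Ne.symm h0)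
    rw [div_eq_div_iff (by positivity) (Real.sqrt_pos.2 hpos).ne', one_mul, Real.mul_self_sqrt hpos.le]

/-- **`‖C‖ = βV²/√(ω_i² + e_K²)`** above the scale (`0 < β`, `0 < Λ ≤ |ω_i|`). -/
theorem norm_uvSymbolCT_eq_of_scale_le_abs_freq (hβ : 0 < β) (hΛ : 0 < Λ) (i : MatsubaraIdx M) (hi : Λ ≤ |matsubaraFreq β M i|)
    (k : TorusSite 2 L) (σ : Fin 2) :
    ‖uvSymbolCT L M β μ K Λ ((i, k), σ)‖ = β * (L : ℝ) ^ 2 / Real.sqrt (matsubaraFreq β M i ^ 2 + nambuXiCT L μ K k ^ 2) := by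
  rw [uvSymbolCT_eq_full_of_scale_le_abs_freq hΛ i hi k σ, norm_mul, norm_I_mul_add_div_sq, Complex.norm_real,
    Real.norm_of_nonneg (by positivity)]
  ring

/-- **Lower bound above the scale**: `βV²/(|ω_i| + 4 + |μ| + ‖K‖₀) ≤ ‖C‖` — `√(ω² + e²) ≤ |ω| + |e|` and `|e_K| ≤ 4 + |μ| + K.coeffNorm 0`. -/
theorem norm_uvSymbolCT_ge_of_scale_le_abs_freq (hβ : 0 < β) (hΛ : 0 < Λ) (i : MatsubaraIdx M) (hi : Λ ≤ |matsubaraFreq β M i|)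
    (k : TorusSite 2 L) (σ : Fin 2) :
    β * (L : ℝ) ^ 2 / (|matsubaraFreq β M i| + (4 + |μ| + K.coeffNorm 0)) ≤ ‖uvSymbolCT L M β μ K Λ ((i, k), σ)‖ := by
  rw [norm_uvSymbolCT_eq_of_scale_le_abs_freq hβ hΛ i hi k σ]
  have hω : 0 < |matsubaraFreq β M i| := lt_of_lt_of_le hΛ hi
  have he := abs_nambuXiCT_le (L := L) μ K k
  have hsq : Real.sqrt (matsubaraFreq β M i ^ 2 + nambuXiCT L μ K k ^ 2) ≤ |matsubaraFreq β M i| + |nambuXiCT L μ K k| := by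
    rw [Real.sqrt_le_left (by positivity)]
    nlinarith [abs_nonneg (matsubaraFreq β M i), abs_nonneg (nambuXiCT L μ K k), sq_abs (matsubaraFreq β M i), sq_abs (nambuXiCT L μ K k)]
  have hω2 : 0 < matsubaraFreq β M i ^ 2 := by rw [← sq_abs]; positivity
  have hpos : 0 < Real.sqrt (matsubaraFreq β M i ^ 2 + nambuXiCT L μ K k ^ 2) :=
    Real.sqrt_pos.2 (by nlinarith [sq_nonneg (nambuXiCT L μ K k)])
  exact div_le_div_of_nonneg_left (by positivity) hpos (hsq.trans (by linarith))

/-! ## §2 At the last KL scale `Λ⋆ = klScale klE0 (nScales β + 1) < π/β ≤ |ω_i|` -/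

/-- `Λ⋆ ≤ |ω_i|` for every Matsubara index (`0 < β`). -/
theorem klScale_nScales_succ_le_abs_matsubaraFreq (hβ : 0 < β) (i : MatsubaraIdx M) :
    klScale klE0 (nScales β + 1) ≤ |matsubaraFreq β M i| :=
  ((klScale_nScales_succ_lt hβ).le).trans (pi_div_le_abs_matsubaraFreq hβ i)

/-- `0 < Λ⋆`. -/
theorem klScale_nScales_succ_pos' (β : ℝ) : 0 < klScale klE0 (nScales β + 1) := by
  unfold klScale
  have : (0 : ℝ) < klE0 := by norm_num [klE0]
  positivity

/-- **The last-scale dressing factor, exact**: `C = βV²·(iω_i + e_K)/(ω_i² + e_K²)` at every label. -/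
theorem uvSymbolCT_lastScale_eq_full (hβ : 0 < β) (i : MatsubaraIdx M) (k : TorusSite 2 L) (σ : Fin 2) :
    uvSymbolCT L M β μ K (klScale klE0 (nScales β + 1)) ((i, k), σ) =
      ((β * (L : ℝ) ^ 2 : ℝ) : ℂ) * ((I * (matsubaraFreq β M i : ℂ) + (nambuXiCT L μ K k : ℂ)) /
        (((matsubaraFreq β M i ^ 2 + nambuXiCT L μ K k ^ 2 : ℝ)) : ℂ)) :=
  uvSymbolCT_eq_full_of_scale_le_abs_freq (klScale_nScales_succ_pos' β) i (klScale_nScales_succ_le_abs_matsubaraFreq hβ i) k σ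

/-- **Lower bound at the last scale**, every label, uniform in `V`, `M`: `βV²/(|ω_i| + 4 + |μ| + ‖K‖₀) ≤ ‖C‖`. -/
theorem norm_uvSymbolCT_lastScale_ge (hβ : 0 < β) (i : MatsubaraIdx M) (k : TorusSite 2 L) (σ : Fin 2) :
    β * (L : ℝ) ^ 2 / (|matsubaraFreq β M i| + (4 + |μ| + K.coeffNorm 0)) ≤ ‖uvSymbolCT L M β μ K (klScale klE0 (nScales β + 1)) ((i, k), σ)‖ :=
  norm_uvSymbolCT_ge_of_scale_le_abs_freq hβ (klScale_nScales_succ_pos' β) i (klScale_nScales_succ_le_abs_matsubaraFreq hβ i) k σ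

/-- **Upper bound** (any scale): `‖C‖ ≤ βV²·(β/π)` (`|ω_i| ≥ π/β`). -/
theorem norm_uvSymbolCT_le_beta (hβ : 0 < β) (Λ : ℝ) (i : MatsubaraIdx M) (k : TorusSite 2 L) (σ : Fin 2) :
    ‖uvSymbolCT L M β μ K Λ ((i, k), σ)‖ ≤ β * (L : ℝ) ^ 2 * (β / Real.pi) := by
  refine (norm_uvSymbolCT_le (L := L) hβ μ K Λ ((i, k), σ)).trans (mul_le_mul_of_nonneg_left ?_ (by positivity))
  have h := pi_div_le_abs_matsubaraFreq hβ i (M := M)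
  rw [one_div, inv_le_comm₀ (lt_of_lt_of_le (by positivity) h) (by positivity), inv_div]
  exact h

/-- **The door's `w₀`, per Matsubara integer**: at every label `i` with `matsubaraInt M i = n`, every `k⃗`, `σ`, `V`, `M`:
`βV²/(π(2|n|+1)/β + 4 + |μ| + ‖K‖₀) ≤ ‖uvSymbolCT V M β μ K Λ⋆ ((i,k⃗),σ)‖`. -/
theorem norm_uvSymbolCT_lastScale_ge_of_matsubaraInt (hβ : 0 < β) {n : ℤ} (i : MatsubaraIdx M) (hi : matsubaraInt M i = n)
    (k : TorusSite 2 L) (σ : Fin 2) :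
    β * (L : ℝ) ^ 2 / (Real.pi * (2 * |(n : ℝ)| + 1) / β + (4 + |μ| + K.coeffNorm 0)) ≤
      ‖uvSymbolCT L M β μ K (klScale klE0 (nScales β + 1)) ((i, k), σ)‖ := by
  refine le_trans ?_ (norm_uvSymbolCT_lastScale_ge hβ i k σ)
  have hω : |matsubaraFreq β M i| ≤ Real.pi * (2 * |(n : ℝ)| + 1) / β := by
    rw [matsubaraFreq, hi, abs_div, abs_of_pos hβ, abs_mul, abs_of_pos Real.pi_pos]
    refine div_le_div_of_nonneg_right (mul_le_mul_of_nonneg_left ?_ Real.pi_pos.le) hβ.le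
    calc |2 * (n : ℝ) + 1| ≤ |2 * (n : ℝ)| + |1| := abs_add_le _ _
      _ = 2 * |(n : ℝ)| + 1 := by rw [abs_mul, abs_two, abs_one]
  have hK : 0 ≤ K.coeffNorm 0 := TrigPolyC4v.coeffNorm_nonneg _ _
  have hpos : 0 < |matsubaraFreq β M i| + (4 + |μ| + K.coeffNorm 0) := by
    have := pi_div_le_abs_matsubaraFreq hβ i (M := M)
    have : 0 < Real.pi / β := by positivity
    positivity
  exact div_le_div_of_nonneg_left (by positivity) hpos (by linarith)

/-- **Normalised form**: `1/(π(2|n|+1)/β + 4 + |μ| + ‖K‖₀) ≤ ‖C‖/(βV²)` — the volume-free scalar. -/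
theorem norm_uvSymbolCT_lastScale_div_ge_of_matsubaraInt (hβ : 0 < β) {n : ℤ} (i : MatsubaraIdx M) (hi : matsubaraInt M i = n)
    (k : TorusSite 2 L) (σ : Fin 2) :
    1 / (Real.pi * (2 * |(n : ℝ)| + 1) / β + (4 + |μ| + K.coeffNorm 0)) ≤
      ‖uvSymbolCT L M β μ K (klScale klE0 (nScales β + 1)) ((i, k), σ)‖ / (β * (L : ℝ) ^ 2) := by
  have hL : (0 : ℝ) < L := by exact_mod_cast Nat.pos_of_ne_zero (NeZero.ne L)
  have hc : 0 < β * (L : ℝ) ^ 2 := by positivity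
  rw [le_div_iff₀ hc, one_div, ← div_eq_inv_mul]
  exact norm_uvSymbolCT_lastScale_ge_of_matsubaraInt hβ i hi k σ

end Summit.HubbardSuperconductivity.HubbardSuperconductivity.Theorems.UVCovarianceAt

end
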